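import Summits.AnomalousDissipation.AnomalousDissipation.Theses.MarginalStabilityChain

/-!
# AnomalousDissipation / MarginalStabilityChain — assembly

Route `AnomalousDissipation/MarginalStabilityChain`, item `Assembly`
(stmt-AnomalousDissipation-10591): the thesis `ChainThesis` (one smooth steady divergence-free
mean-zero force `f` on `T³`, viscosities `ν_j → 0`, complete classical solutions `(u_j, p_j)` of
`NS_{ν_j}` forced by `f` on `ℝ × T³`, `ν`-uniform bound on the mean energy, mean dissipation
`≥ ε > 0`) implies the summit statement `AnomalousDissipation = Literature.Turb.ZerothLaw`.

Proof: take the data `u₀ j := u j 0`; each complete classical solution is a global Leray–Hopf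
solution from its time-`0` slice by the discharged Literature theorem
`Literature.Analysis.FunctionSpaces.Torus.IsClassicalNSSolutionOn.isGlobalLerayHopf`
(`Literature/Analysis/FluidPDE/TorusClassicalLerayHopfProofs.lean`; Galdi 2000 Thm 4.1,
Robinson–Rodrigo–Sadowski 2016 Thm 6.5); the energy and dissipation clauses of the thesis are those
of `ZerothLaw` verbatim. The term is self-contained (it does not cite the route's deciding theorem).
-/

-- `Summit.<Summit>.<Problem>` is the tree's mandated summit-side namespace (CONVENTIONS §2); for this
-- single-conjunct summit the two coincide, so the duplicate is deliberate.
set_option linter.dupNamespace false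

namespace Summit.AnomalousDissipation.AnomalousDissipation.Theorems

/-- Settles stmt-AnomalousDissipation-10591 (assembly of route `MarginalStabilityChain`):
`ChainThesis → AnomalousDissipation`. Data `u₀ j := u j 0`; every complete classical solution with a
smooth steady force is a global Leray–Hopf solution from its time-`0` slice
(`Torus.IsClassicalNSSolutionOn.isGlobalLerayHopf`, Galdi 2000 Thm 4.1); the remaining clauses of
`Literature.Turb.ZerothLaw` are those of the thesis verbatim. [folklore] -/
theorem marginalStabilityChain_assembly_proof :
    Summit.AnomalousDissipation.AnomalousDissipation.Theses.MarginalStabilityChain.Assembly := by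
  unfold Summit.AnomalousDissipation.AnomalousDissipation.Theses.MarginalStabilityChain.Assembly
  intro hX
  obtain ⟨f, hf, hdiv, hmean, ν, u, p, hν, hν0, hsol, hE, hε⟩ := hX
  exact ⟨f, hf, hdiv, hmean, ν, fun j => u j 0, u, hν, hν0, fun j => (hsol j).isGlobalLerayHopf,
    hE, hε⟩

end Summit.AnomalousDissipation.AnomalousDissipation.Theorems
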